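import Mathlib
import Literature.Computability.AlgebraicComplexity.DeterminantalComplexity
import Literature.Computability.AlgebraicComplexity.StandardFamilies
import Literature.Computability.AlgebraicComplexity.LRPencilOfMatrix

/-!
# Crux `ToricWitnessObstructionQP` (stmt-ValiantsHypothesis-14753), line `Sketch` — CALIBRATION of the
# open stub `stub_toricBorderLower`

An affine determinantal representation of `per_n` of size `m` is a torus leading form `TLF(n,m)` with
all weights `0` (`tlf_of_hasDetRepr`).  Consequently the open stub of line `Sketch`,
`stub_toricBorderLower : TLF(n,m) → 2^n - 1 ≤ m`, implies `HasDetRepr per_n m → 2^n - 1 ≤ m` for all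
`3 ≤ n ≤ m`, i.e. that Grenet's `2^n - 1` is the EXACT determinantal complexity of the permanent
(`grenet_optimal_of_toricBorderLower`), and even its weakest sufficient (asymptotic) form
`NoTLFQP` implies that `dc(per_n)` is eventually super-quasi-polynomial, a statement of the strength
of Valiant's hypothesis (`dc_superQP_of_noTLFQP`).  These are certificates that the residual stub is
crux-sized (indeed VH-sized), for the planner; nothing here is used by the composition.
-/

open MvPolynomial
open scoped BigOperators Matrix
open Literature.Computability.AlgebraicComplexity

-- the mandated summit-side namespace repeats a component by design (single-problem summit)
set_option linter.dupNamespace false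

namespace Summit.ValiantsHypothesis.ValiantsHypothesis.Theorems.BorderApolarityToricWitnessObstructionQP

noncomputable section

/-- **Affine representations are torus leading forms with zero weights.**  If `per_n = det A` for an
`m × m` matrix `A` of affine linear forms, then `TLF(n,m)` holds with `e' = a₀ = 0`, `γ = 0`,
`G₀ = A(0)` and `G_ij` the coefficient matrix of `Y_ij`. [folklore] -/
theorem tlf_of_hasDetRepr (n m : ℕ) (h : HasDetRepr (perPoly (Fin n) ℂ) m) :
    ∃ (e' a₀ : ℕ) (γ : Fin n → Fin n → ℕ) (G₀ : Matrix (Fin m) (Fin m) ℂ)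
      (G : Fin n → Fin n → Matrix (Fin m) (Fin m) ℂ),
      (∀ i j k l : Fin n, γ i j + γ k l = γ i l + γ k j) ∧
      (Matrix.of fun a b : Fin m => Polynomial.monomial a₀ (C (G₀ a b)) +
        ∑ i : Fin n, ∑ j : Fin n, Polynomial.monomial (γ i j) (C (G i j a b) * X (i, j)) :
          Matrix (Fin m) (Fin m) (Polynomial (MvPolynomial (Fin n × Fin n) ℂ))).det.natDegree ≤ e' ∧
      (Matrix.of fun a b : Fin m => Polynomial.monomial a₀ (C (G₀ a b)) +
        ∑ i : Fin n, ∑ j : Fin n, Polynomial.monomial (γ i j) (C (G i j a b) * X (i, j)) :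
          Matrix (Fin m) (Fin m) (Polynomial (MvPolynomial (Fin n × Fin n) ℂ))).det.coeff e' =
        perPoly (Fin n) ℂ := by
  classical
  obtain ⟨A, hdeg, hdet⟩ := h
  refine ⟨0, 0, fun _ _ => 0, Matrix.of fun a b => coeff 0 (A a b),
    fun i j => Matrix.of fun a b => coeff (Finsupp.single (i, j) 1) (A a b), fun _ _ _ _ => rfl, ?_⟩
  -- the pencil is the constant (in `s`) matrix `A`
  have hM : (Matrix.of fun a b : Fin m => Polynomial.monomial 0 (C ((Matrix.of fun a b => coeff 0 (A a b)) a b)) +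
        ∑ i : Fin n, ∑ j : Fin n, Polynomial.monomial ((fun _ _ => (0 : ℕ)) i j)
          (C ((fun i j => Matrix.of fun a b => coeff (Finsupp.single (i, j) 1) (A a b)) i j a b) * X (i, j)) :
          Matrix (Fin m) (Fin m) (Polynomial (MvPolynomial (Fin n × Fin n) ℂ))) =
      A.map Polynomial.C := by
    ext1 a b
    simp only [Matrix.of_apply, Matrix.map_apply, Polynomial.monomial_zero_left]
    rw [← Finset.sum_product', ← map_sum, ← map_add]
    congr 1
    conv_rhs => rw [LRPencil.eq_affine_of_totalDegree_le_one (A a b) (hdeg a b)]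
    rw [Finset.univ_product_univ]
  rw [hM]
  have hdetC : (A.map Polynomial.C).det = Polynomial.C (perPoly (Fin n) ℂ) := by
    rw [← hdet]; exact (RingHom.map_det (Polynomial.C : MvPolynomial (Fin n × Fin n) ℂ →+* _) A).symm
  rw [hdetC]
  exact ⟨(Polynomial.natDegree_C _).le, Polynomial.coeff_C_zero⟩

/-- **Calibration 1: the strong stub asserts that Grenet is optimal.**  If every torus leading form
of `per_n` (`n ≥ 3`) has size `≥ 2^n - 1` (the registered stub `stub_toricBorderLower`), then every
affine determinantal representation of `per_n` has size `≥ 2^n - 1`, i.e. `dc(per_n) = 2^n - 1`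
(Grenet's bound being the matching upper bound) — open beyond `n = 3`. [folklore] -/
theorem grenet_optimal_of_toricBorderLower
    (hS6 : ∀ (n m : ℕ), 3 ≤ n → n ≤ m →
      (∃ (e' a₀ : ℕ) (γ : Fin n → Fin n → ℕ) (G₀ : Matrix (Fin m) (Fin m) ℂ)
        (G : Fin n → Fin n → Matrix (Fin m) (Fin m) ℂ),
        (∀ i j k l : Fin n, γ i j + γ k l = γ i l + γ k j) ∧
        (Matrix.of fun a b : Fin m => Polynomial.monomial a₀ (C (G₀ a b)) +
          ∑ i : Fin n, ∑ j : Fin n, Polynomial.monomial (γ i j) (C (G i j a b) * X (i, j)) :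
            Matrix (Fin m) (Fin m) (Polynomial (MvPolynomial (Fin n × Fin n) ℂ))).det.natDegree ≤ e' ∧
        (Matrix.of fun a b : Fin m => Polynomial.monomial a₀ (C (G₀ a b)) +
          ∑ i : Fin n, ∑ j : Fin n, Polynomial.monomial (γ i j) (C (G i j a b) * X (i, j)) :
            Matrix (Fin m) (Fin m) (Polynomial (MvPolynomial (Fin n × Fin n) ℂ))).det.coeff e' =
          perPoly (Fin n) ℂ) →
      2 ^ n - 1 ≤ m) :
    ∀ (n m : ℕ), 3 ≤ n → n ≤ m → HasDetRepr (perPoly (Fin n) ℂ) m → 2 ^ n - 1 ≤ m :=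
  fun n m h3 hnm h => hS6 n m h3 hnm (tlf_of_hasDetRepr n m h)

/-- **Calibration 2: even the weakest sufficient form of the stub is VH-sized.**  If for every `c`
there are eventually (in `n`) no torus leading forms of `per_n` of size `m` in the quasi-polynomial
window `n ≤ m ≤ 2^((log₂ n + c)^c)` (`NoTLFQP`, what the composition actually needs), then `per_n`
eventually has no affine determinantal representation of quasi-polynomial size — the eventual
super-quasi-polynomial determinantal complexity of the permanent, which implies Valiant's hypothesis
on its own. [folklore] -/
theorem dc_superQP_of_noTLFQP
    (hNo : ∀ c : ℕ, ∃ n₀ : ℕ, ∀ n ≥ n₀, ∀ m : ℕ, n ≤ m → m ≤ 2 ^ ((Nat.log 2 n + c) ^ c) →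
      ¬ ∃ (e' a₀ : ℕ) (γ : Fin n → Fin n → ℕ) (G₀ : Matrix (Fin m) (Fin m) ℂ)
        (G : Fin n → Fin n → Matrix (Fin m) (Fin m) ℂ),
        (∀ i j k l : Fin n, γ i j + γ k l = γ i l + γ k j) ∧
        (Matrix.of fun a b : Fin m => Polynomial.monomial a₀ (C (G₀ a b)) +
          ∑ i : Fin n, ∑ j : Fin n, Polynomial.monomial (γ i j) (C (G i j a b) * X (i, j)) :
            Matrix (Fin m) (Fin m) (Polynomial (MvPolynomial (Fin n × Fin n) ℂ))).det.natDegree ≤ e' ∧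
        (Matrix.of fun a b : Fin m => Polynomial.monomial a₀ (C (G₀ a b)) +
          ∑ i : Fin n, ∑ j : Fin n, Polynomial.monomial (γ i j) (C (G i j a b) * X (i, j)) :
            Matrix (Fin m) (Fin m) (Polynomial (MvPolynomial (Fin n × Fin n) ℂ))).det.coeff e' =
          perPoly (Fin n) ℂ) :
    ∀ c : ℕ, ∃ n₀ : ℕ, ∀ n ≥ n₀, ∀ m : ℕ, n ≤ m → m ≤ 2 ^ ((Nat.log 2 n + c) ^ c) →
      ¬ HasDetRepr (perPoly (Fin n) ℂ) m := by
  intro c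
  obtain ⟨n₀, hn₀⟩ := hNo c
  exact ⟨n₀, fun n hn m hnm hm h => hn₀ n hn m hnm hm (tlf_of_hasDetRepr n m h)⟩

end

end Summit.ValiantsHypothesis.ValiantsHypothesis.Theorems.BorderApolarityToricWitnessObstructionQP
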